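import Summits.QuantumAdvantage.QuantumAdvantage.Theses.LinnikCubicClassGroups
import Mathlib.NumberTheory.NumberField.ClassNumber

/-!
# Crux `LinnikCubicClassGroups.PureCubicClassGroupFBQP` (stmt-QuantumAdvantage-11544) — stub `stub_classTableSem`, part INDEX

Line `arakelov-giant-step-cycle`, stub `stub_classTableSem` (S5b-P5b): two bookkeeping lemmas of the structural interface.

* `closure_slots_eq` — the subgroup of the class group generated by the classes of the generator SLOTS (degree-one primes above the
  primes of `ps`, and copies of `𝓞_K`) is the subgroup generated by the classes of ALL primes of norm in `ps` (each occurs as a slot;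
  the unit slots contribute `1`);
* `defects_biUnion` — the global defect set assembled from per-block bad index sets `B E ⊆ [0, J)`: its size is at most `W · c` when
  each `|B E| ≤ c`, and a position `E + W j` outside it has `j ∉ B E`.
-/

set_option linter.dupNamespace false

namespace Summit.QuantumAdvantage.QuantumAdvantage.Theorems.LinnikCubicClassGroups

open scoped NumberField nonZeroDivisors
open NumberField

/-- **The slot classes generate the subgroup of the degree-one primes above `ps`.** -/
theorem closure_slots_eq {K : Type} [Field K] [NumberField K] {T : ℕ} (𝔤 : ℕ → Ideal (𝓞 K))
    (h𝔤 : ∀ t, t < T → 𝔤 t ≠ ⊥) (ps : List ℕ)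
    (hkind : ∀ t, t < T → 𝔤 t = ⊤ ∨ ((𝔤 t).IsPrime ∧ Ideal.absNorm (𝔤 t) ∈ ps))
    (hall : ∀ p ∈ ps, ∀ Q : Ideal (𝓞 K), Q.IsPrime → Ideal.absNorm Q = p → ∃ t, t < T ∧ 𝔤 t = Q) :
    Subgroup.closure (Set.range fun t : Fin T =>
        ClassGroup.mk0 (⟨𝔤 t, mem_nonZeroDivisors_iff_ne_zero.mpr (h𝔤 t t.isLt)⟩ : (Ideal (𝓞 K))⁰)) =
      Subgroup.closure {c : ClassGroup (𝓞 K) | ∃ p ∈ ps, ∃ P : Ideal (𝓞 K), ∃ hP : P ∈ nonZeroDivisors (Ideal (𝓞 K)),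
        P.IsPrime ∧ Ideal.absNorm P = p ∧ c = ClassGroup.mk0 ⟨P, hP⟩} := by
  apply le_antisymm
  · rw [Subgroup.closure_le]
    rintro c ⟨t, rfl⟩
    rcases hkind t t.isLt with htop | ⟨hpr, hmem⟩
    · have h1 : (⟨𝔤 t, mem_nonZeroDivisors_iff_ne_zero.mpr (h𝔤 t t.isLt)⟩ : (Ideal (𝓞 K))⁰) = 1 := by
        apply Subtype.ext; simp only [OneMemClass.coe_one]; rw [Ideal.one_eq_top]; exact htop
      simp only [h1, map_one]
      exact (Subgroup.closure _).one_mem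
    · exact Subgroup.subset_closure ⟨_, hmem, 𝔤 t, mem_nonZeroDivisors_iff_ne_zero.mpr (h𝔤 t t.isLt), hpr, rfl, rfl⟩
  · rw [Subgroup.closure_le]
    rintro c ⟨p, hp, P, hP, hpr, hnorm, rfl⟩
    obtain ⟨t, ht, htP⟩ := hall p hp P hpr hnorm
    refine Subgroup.subset_closure ⟨⟨t, ht⟩, ?_⟩
    simp only
    congr 1
    exact Subtype.ext htP

/-- **The global defect set from per-block bad sets.** -/
theorem defects_biUnion {W : ℕ} (hW : 0 < W) (B : ℕ → Finset ℕ) {c : ℝ} (hB : ∀ E, E < W → ((B E).card : ℝ) ≤ c) :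
    ((((Finset.range W).biUnion (fun E => (B E).image (fun j => E + W * j))).card : ℕ) : ℝ) ≤ W * c ∧
      ∀ E, E < W → ∀ j, E + W * j ∉ (Finset.range W).biUnion (fun E => (B E).image (fun j => E + W * j)) → j ∉ B E := by
  have _ := hW
  constructor
  · calc ((((Finset.range W).biUnion (fun E => (B E).image (fun j => E + W * j))).card : ℕ) : ℝ)
        ≤ ((∑ E ∈ Finset.range W, ((B E).image (fun j => E + W * j)).card : ℕ) : ℝ) := by
          exact_mod_cast Finset.card_biUnion_le
      _ ≤ ∑ E ∈ Finset.range W, ((B E).card : ℝ) := by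
          push_cast; exact Finset.sum_le_sum fun E _ => by exact_mod_cast Finset.card_image_le
      _ ≤ ∑ E ∈ Finset.range W, c := Finset.sum_le_sum fun E hE => hB E (Finset.mem_range.mp hE)
      _ = W * c := by rw [Finset.sum_const, Finset.card_range]; simp
  · intro E hE j hv hj
    exact hv (Finset.mem_biUnion.mpr ⟨E, Finset.mem_range.mpr hE, Finset.mem_image.mpr ⟨j, hj, rfl⟩⟩)

/-- **P5b helper `classTableSem_defects_biUnion`** (registered): the global defect set from per-block bad sets. -/
theorem classTableSem_defects_biUnion : ∀ (W : ℕ), 0 < W → ∀ (B : ℕ → Finset ℕ) (c : ℝ), (∀ E, E < W → ((B E).card : ℝ) ≤ c) → ((((Finset.range W).biUnion (fun E => (B E).image (fun j => E + W * j))).card : ℕ) : ℝ) ≤ W * c ∧ ∀ E, E < W → ∀ j, E + W * j ∉ (Finset.range W).biUnion (fun E => (B E).image (fun j => E + W * j)) → j ∉ B E :=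
  fun _ hW B _ hB => defects_biUnion hW B hB

end Summit.QuantumAdvantage.QuantumAdvantage.Theorems.LinnikCubicClassGroups
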